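import Summits.QuantumFields.BalabanUV.Beta.GAN24.E3UnitSplitSum
import Summits.QuantumFields.BalabanUV.Beta.GAN24.StencilSlotOfShapes

/-!
# `BalabanUV.Beta.GAN24.StencilSlotE3OfPieces` — binder row G-an2-4 / (CONV-C), S-slot, road «S3»: «E3Shape» AS A KERNEL-CHECKED
# FUNCTION OF PER-PIECE, PER-LEVEL SHAPES (the END-as-function of the S3 leaf table; row owner b2b-balaban-gan24-p1, gen 4)

NOT IN PRINT; OUR PROOF ATTEMPT.  HONEST FRAMING (cell contract, verbatim): «discharging `BetaPertH` makes Bałaban's UV stability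
UNCONDITIONAL — a real constructive-QFT result; it is NOT the continuum limit and NOT the Clay problem.»  HONEST DEPENDENCY (verbatim):
«continuum YM on T⁴ ⇐ BetaPertH ∧ nine spine estimates (0/9 proved); BetaPertH ⇐ (D1) ∧ (D4) ∧ CAP+tail; G-an2-4 gates asym, D1 and
NE2/3/4.»  [folklore] bookkeeping over an2's DEFINITIONS (`BalabanStepJetsSucc.e3Of`/`wE`, `HessKerDressedUnits.unitS`, the K-slot units
`CombesThomas.sfStep`/`smStep`) and leaf-01's member decomposition `E3UnitSplit.e3Of_succ_succ_decomp` BY NAME; 0 `def`, 0 cite, 0 `Prop`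
mirror, 0 sorry.  Discharges NOTHING of «E3Shape» / «E3SupRate», (hS, hSall), BetaPertH: it only fixes, IN THE KERNEL, what the S3 leaves
must prove.  NOT continuum, NOT Clay.

## What is proved (generic `d`, `Lc ≥ 1`)
* §1 `e3_scalar`, `unitS_e3Of` — the (U-S3) NORMAL FORM of the wall's stencil units on the third-jet summand: at the adopted K-slot units
  `(sfStep Lc (j+1), smStep d Lc (j+1)) = (N, N^{d+1})`, `N = Lc^{j+1}`,
  `unitS … ((cE·wE d Lc (j+1)) • e3Of … (j+1)) = (cE·N^{2(d+1)}) • e3Of … (j+1)`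
  (`StencilSlotLam.unitS_smul_ffOnly`: `e3Of` is an `mm`-read, field–field-supported; exponent identity `−1 −(d+1) −2 + 3(d+2) = 2(d+1)`).
* §2 `sum_pow_sub_le` — the level sum `Σ_{m<n} θ^{n−m} ≤ θ/(1−θ)` (`0 ≤ θ < 1`); `abs_weighted_sum_le` — real bookkeeping.
* §3 **`e3Shape_of_pieces`** — «E3Shape» (LITERALLY the hypothesis `hE3` of `StencilSlotOfShapes.hS_of_shapes` /
  `StencilSlotCauchyOfShapes.hSall_of_shapes` / `StencilSlotOfE3.hS_of_e3`) FROM SEVEN FAMILIES of per-piece shapes, one per summand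
  kind of the member decomposition (member `n+2`, `N = Lc^{n+2}`; every hypothesis is a `LocStencil` bound of the family
  `N^{2(d+1)} · e3OfS N (piece)` with the piece VERBATIM as it occurs in `e3Of_succ_succ_decomp`): Wilson (`CW`, n-uniform); level-`0`
  (V-H) and Λ pushed `n+1` times (`c₀V·θ^{n+1}`, `c₀L·θ^{n+1}`); top border / top Λ increment (`CtV`, `CtL`, n-uniform); the levels
  `m+1`, `m < n`, pushed `n−m` times (`cV·θ^{n−m}`, `cL·θ^{n−m}`).  Member `1` needs NO hypothesis (an2's `locStencil_e3Of` at `j = 1`).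
  Output: constant `max (|cE·Lc^{2(d+1)}|·C₁) (|cE|·(CW + |c₀V| + |c₀L| + CtV + CtL + (|cV| + |cL|)·θ/(1−θ)))`, rate `min δ₁ δ`.
So the S3 LEAF TABLE of `SKELETON-S3.md` v1.0 is, row by row, the hypothesis list of `e3Shape_of_pieces`; the first proof line of every
row is the matching unit-split identity of `GAN24/E3UnitSplitLevels`/`E3UnitSplitSum` (`e3W_unit_split`, `e3VH0_unit_split`,
`e3Lam0_unit_split`, `e3VHTop_unit_split`, `e3LamTop_unit_split`, `e3VH_unit_split`, `e3Lam_unit_split`), which rewrites the row into a bound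
on ONE explicit unit sandwich with a displayed residual power.  READING (displayed, not claimed): the expected mechanism behind the
geometric factor is the amplitude count of the one-step averaging jets on minimiser columns smooth on scale `N` (`θ = Lc⁻¹` or `Lc⁻²`);
the diagnostics D-S3-2 decide; a hypothesis family that fails numerically is reported, not assumed.
-/

noncomputable section

open Finset
open scoped BigOperators
open Literature.MathematicalPhysics.QuantumFieldTheory
open Literature.MathematicalPhysics.QuantumFieldTheory.Balaban1983to89
open Literature.MathematicalPhysics.QuantumFieldTheory.Balaban1983to89.Beta
open ExpKernelCalculus (MKer BiLoc)
open OneStepResolventKernel (Fib LocStencil KInv)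
open StepJetData (wilsonA mfNeg locStencil_smul)
open AveragingHessianKernels (vhS hessFF)
open InterLevelTransport (SLam)
open BalabanStepJets (lamCoeffOf locStencil_mono)
open BalabanCompositeJets (pushSum borderInc lagrInc)
open BalabanStepJetsSucc (e3Of wE locStencil_e3Of)
open B12Sec2to5 (l1 l1_nonneg)
open Summit.QuantumFields.BalabanUV.Beta.HessKerDressedUnits (unitS)
open Summit.QuantumFields.BalabanUV.Beta.GAN24.CombesThomas (sfStep smStep)
open Summit.QuantumFields.BalabanUV.Beta.GAN24.StencilSlotLam (unitS_smul_ffOnly)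
open Summit.QuantumFields.BalabanUV.Beta.GAN24.StencilSlotOfShapes (locStencil_const_mono)
open Summit.QuantumFields.BalabanUV.Beta.GAN24.E3UnitSplit (e3OfS e3Of_succ_eq_e3OfS e3OfS_inl_inr e3OfS_inr e3Of_succ_succ_decomp)

namespace Summit.QuantumFields.BalabanUV.Beta.GAN24.StencilSlotE3OfPieces

variable {d : ℕ} {Lc : ℕ} [NeZero Lc]

/-! ## §1 The (U-S3) normal form of the stencil units on the third-jet summand -/

/-- [folklore] The exponent identity of (U-S3): `(N·N^{d+1})⁻¹·(N⁻¹·N⁻¹)·(cE·N^{3(d+2)}) = cE·N^{2(d+1)}`, `N = Lc^{j+1}`. -/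
theorem e3_scalar (cE : ℝ) (j : ℕ) :
    (sfStep Lc (j + 1) * smStep d Lc (j + 1))⁻¹ * ((sfStep Lc (j + 1))⁻¹ * (sfStep Lc (j + 1))⁻¹) * (cE * wE d Lc (j + 1)) =
      cE * ((Lc : ℝ) ^ (j + 1)) ^ (2 * (d + 1)) := by
  have hL : (0 : ℝ) < (Lc : ℝ) := by exact_mod_cast Nat.pos_of_ne_zero (NeZero.ne Lc)
  have hsf : sfStep Lc (j + 1) = (Lc : ℝ) ^ (j + 1) := rfl
  have hsm : smStep d Lc (j + 1) = ((Lc : ℝ) ^ (j + 1)) ^ (d + 1) := by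
    rw [← pow_mul]; rfl
  have hwE : wE d Lc (j + 1) = ((Lc : ℝ) ^ (j + 1)) ^ (3 * (d + 2)) := rfl
  rw [hsf, hsm, hwE]
  have hN0 : ((Lc : ℝ) ^ (j + 1)) ≠ 0 := pow_ne_zero _ hL.ne'
  have h3 : ((Lc : ℝ) ^ (j + 1)) ^ (3 * (d + 2)) =
      ((Lc : ℝ) ^ (j + 1)) ^ (2 * (d + 1)) * (((Lc : ℝ) ^ (j + 1)) * ((Lc : ℝ) ^ (j + 1)) ^ (d + 1) *
        (((Lc : ℝ) ^ (j + 1)) * ((Lc : ℝ) ^ (j + 1)))) := by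
    rw [← pow_succ', ← pow_two, ← pow_add, ← pow_add]; congr 1; ring
  rw [h3]
  field_simp

/-- [folklore] **(U-S3) NORMAL FORM**: at the adopted units the wall's rescaled third-jet summand of member `j+1` is the scalar multiple
`(cE·N^{2(d+1)}) • e3Of … (j+1)`, `N = Lc^{j+1}` (`e3Of` is an `mm`-read, hence field–field-supported). -/
theorem unitS_e3Of (cE cVH cΛ : ℝ) (j : ℕ) :
    unitS (sfStep Lc (j + 1)) (smStep d Lc (j + 1)) (fun κ u => (cE * wE d Lc (j + 1)) • e3Of d Lc cE cVH cΛ (j + 1) κ u) =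
      fun κ u => (cE * ((Lc : ℝ) ^ (j + 1)) ^ (2 * (d + 1))) • e3Of d Lc cE cVH cΛ (j + 1) κ u := by
  rw [unitS_smul_ffOnly _ _ _ (fun κ u => e3Of d Lc cE cVH cΛ (j + 1) κ u)
    (fun κ u x y α ν => by rw [e3Of_succ_eq_e3OfS]; exact e3OfS_inl_inr _ κ u x y α ν)
    (fun κ u x y ν α => by rw [e3Of_succ_eq_e3OfS]; exact e3OfS_inr _ κ u x y ν (Sum.inl α))
    (fun κ u x y ν ν' => by rw [e3Of_succ_eq_e3OfS]; exact e3OfS_inr _ κ u x y ν (Sum.inr ν'))]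
  rw [e3_scalar]

/-! ## §2 Real bookkeeping: the level sum and weighted triangle inequalities -/

/-- [folklore] `Σ_{m<n} θ^{n−m} ≤ θ/(1−θ)` for `0 ≤ θ < 1`. -/
theorem sum_pow_sub_le {θ : ℝ} (h0 : 0 ≤ θ) (h1 : θ < 1) (n : ℕ) :
    ∑ m ∈ Finset.range n, θ ^ (n - m) ≤ θ / (1 - θ) := by
  have hre : ∑ m ∈ Finset.range n, θ ^ (n - m) = ∑ k ∈ Finset.range n, θ ^ (k + 1) := by
    rw [← Finset.sum_range_reflect (fun k => θ ^ (k + 1)) n]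
    refine Finset.sum_congr rfl fun m hm => ?_
    have hmn : m < n := Finset.mem_range.1 hm
    congr 1; omega
  rw [hre]
  have hs : Summable fun k : ℕ => θ ^ k := summable_geometric_of_lt_one h0 h1
  calc ∑ k ∈ Finset.range n, θ ^ (k + 1) = θ * ∑ k ∈ Finset.range n, θ ^ k := by
        rw [Finset.mul_sum]; exact Finset.sum_congr rfl fun k _ => pow_succ' θ k
    _ ≤ θ * ∑' k : ℕ, θ ^ k :=
        mul_le_mul_of_nonneg_left (hs.sum_le_tsum _ fun k _ => pow_nonneg h0 k) h0
    _ = θ / (1 - θ) := by rw [tsum_geometric_of_lt_one h0 h1]; ring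

/-- [folklore] The weighted triangle inequality in the shape of the member decomposition (five single pieces and one level sum of two
pieces, all multiplied by the same scalar `t`, all bounded by constants times the same weight `E`). -/
theorem abs_weighted_sum_le {ι : Type*} (s : Finset ι) {t A B C D F E a b c d' f : ℝ} {G H g h : ι → ℝ}
    (hA : |t * A| ≤ a * E) (hB : |t * B| ≤ b * E) (hC : |t * C| ≤ c * E) (hD : |t * D| ≤ d' * E) (hF : |t * F| ≤ f * E)
    (hG : ∀ i ∈ s, |t * G i| ≤ g i * E) (hH : ∀ i ∈ s, |t * H i| ≤ h i * E) :
    |t * (A + B + C + D + F + ∑ i ∈ s, (G i + H i))| ≤ (a + b + c + d' + f + ∑ i ∈ s, (g i + h i)) * E := by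
  have hsum : |t * ∑ i ∈ s, (G i + H i)| ≤ (∑ i ∈ s, (g i + h i)) * E := by
    rw [Finset.mul_sum, Finset.sum_mul]
    refine (Finset.abs_sum_le_sum_abs _ _).trans (Finset.sum_le_sum fun i hi => ?_)
    rw [mul_add, add_mul]
    exact (abs_add_le _ _).trans (add_le_add (hG i hi) (hH i hi))
  have e : t * (A + B + C + D + F + ∑ i ∈ s, (G i + H i)) =
      t * A + t * B + t * C + t * D + t * F + t * ∑ i ∈ s, (G i + H i) := by ring
  rw [e]
  have t₁ := abs_add_le (t * A + t * B + t * C + t * D + t * F) (t * ∑ i ∈ s, (G i + H i))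
  have t₂ := abs_add_le (t * A + t * B + t * C + t * D) (t * F)
  have t₃ := abs_add_le (t * A + t * B + t * C) (t * D)
  have t₄ := abs_add_le (t * A + t * B) (t * C)
  have t₅ := abs_add_le (t * A) (t * B)
  calc |t * A + t * B + t * C + t * D + t * F + t * ∑ i ∈ s, (G i + H i)|
      ≤ |t * A| + |t * B| + |t * C| + |t * D| + |t * F| + |t * ∑ i ∈ s, (G i + H i)| := by linarith
    _ ≤ a * E + b * E + c * E + d' * E + f * E + (∑ i ∈ s, (g i + h i)) * E :=
      add_le_add (add_le_add (add_le_add (add_le_add (add_le_add hA hB) hC) hD) hF) hsum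
    _ = (a + b + c + d' + f + ∑ i ∈ s, (g i + h i)) * E := by ring

/-! ## §3 «E3Shape» from per-piece, per-level shapes -/

/-- [folklore] A pointwise bound of `BiLoc` type from a `LocStencil` hypothesis, at a weaker rate. -/
theorem abs_le_of_locStencil {S : Fin (d + 1) → (Fin (d + 1) → ℤ) → MKer (d + 1) (Fib d)} {C δ δ' : ℝ}
    (h : LocStencil S C δ) (hle : δ' ≤ δ) (κ' : Fin (d + 1)) (u' x z : Fin (d + 1) → ℤ) (a b : Fib d) :
    |S κ' u' x z a b| ≤ C * Real.exp (-δ' * (l1 (x - u') + l1 (z - u'))) := by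
  have hC : 0 ≤ C := (h κ' u').nonneg (Sum.inl 0)
  refine (h κ' u' x z a b).trans (mul_le_mul_of_nonneg_left ?_ hC)
  rw [Real.exp_le_exp]
  have h1 := l1_nonneg (x - u')
  have h2 := l1_nonneg (z - u')
  nlinarith

/-- **«E3Shape» FROM PER-PIECE, PER-LEVEL SHAPES** (generic `d`, `Lc ≥ 1`).  Hypotheses, for every `n` (member `n+2`, `N = Lc^{n+2}`,
pieces and weights VERBATIM from `E3UnitSplit.e3Of_succ_succ_decomp`, common rate `δ > 0`, ratio `0 ≤ θ < 1`): `hW` Wilson (n-uniform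
`CW`); `hV0`/`hL0` the level-`0` (V-H)/Λ pieces of `S₀` pushed `n+1` times (`c₀V·θ^{n+1}`, `c₀L·θ^{n+1}`); `hVt`/`hLt` the top border /
top Λ increment (n-uniform `CtV`, `CtL`); `hV`/`hL` the levels `m+1`, `m < n`, pushed `n−m` times (`cV·θ^{n−m}`, `cL·θ^{n−m}`).
Conclusion: LITERALLY the hypothesis «E3Shape» of the S-slot ENDs (`StencilSlotOfShapes.hS_of_shapes`, `StencilSlotCauchyOfShapes.hSall_of_shapes`,
`StencilSlotOfE3.hS_of_e3` at `d = 3`), with an explicit constant and the rate `min δ₁ δ`, `δ₁` the rate of an2's `locStencil_e3Of` at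
member `1`. [folklore] -/
theorem e3Shape_of_pieces (hLc : 1 ≤ Lc) (cE cVH cΛ : ℝ) {δ θ CW c₀V c₀L CtV CtL cV cL : ℝ} (hδ : 0 < δ) (hθ0 : 0 ≤ θ) (hθ1 : θ < 1)
    (hW : ∀ n : ℕ, LocStencil (fun κ' u' x' z' a b => ((Lc : ℝ) ^ (n + 1 + 1)) ^ (2 * (d + 1)) *
      e3OfS (Lc ^ (n + 1 + 1)) (fun κ u => (cE * ((Lc : ℝ) ^ (d + 1)) ^ (n + 1)) • wilsonA d κ u) κ' u' x' z' a b) CW δ)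
    (hV0 : ∀ n : ℕ, LocStencil (fun κ' u' x' z' a b => ((Lc : ℝ) ^ (n + 1 + 1)) ^ (2 * (d + 1)) *
      e3OfS (Lc ^ (n + 1 + 1)) (fun κ u => (((Lc : ℝ) ^ (d + 1)) ^ (n + 1) * cVH) • pushSum Lc (Lc ^ (n + 1)) (mfNeg (vhS d Lc κ u)))
        κ' u' x' z' a b) (c₀V * θ ^ (n + 1)) δ)
    (hL0 : ∀ n : ℕ, LocStencil (fun κ' u' x' z' a b => ((Lc : ℝ) ^ (n + 1 + 1)) ^ (2 * (d + 1)) *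
      e3OfS (Lc ^ (n + 1 + 1)) (fun κ u => (((Lc : ℝ) ^ (d + 1)) ^ (n + 1) * cΛ) •
        SLam Lc (lamCoeffOf (KInv (N := Lc) (d := d)) Lc) (fun μ y => hessFF Lc μ y) κ u) κ' u' x' z' a b) (c₀L * θ ^ (n + 1)) δ)
    (hVt : ∀ n : ℕ, LocStencil (fun κ' u' x' z' a b => ((Lc : ℝ) ^ (n + 1 + 1)) ^ (2 * (d + 1)) *
      e3OfS (Lc ^ (n + 1 + 1)) (fun κ u => (cVH * ((Lc : ℝ) ^ (n + 1)) ^ (d + 2)) • borderInc d Lc (Lc ^ (n + 1)) κ u)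
        κ' u' x' z' a b) CtV δ)
    (hLt : ∀ n : ℕ, LocStencil (fun κ' u' x' z' a b => ((Lc : ℝ) ^ (n + 1 + 1)) ^ (2 * (d + 1)) *
      e3OfS (Lc ^ (n + 1 + 1)) (fun κ u => (cΛ * ((Lc : ℝ) ^ (n + 1)) ^ (2 * d + 4)) •
        lagrInc d Lc (Lc ^ (n + 1)) (Lc ^ (n + 1 + 1)) κ u) κ' u' x' z' a b) CtL δ)
    (hV : ∀ n m : ℕ, m < n → LocStencil (fun κ' u' x' z' a b => ((Lc : ℝ) ^ (n + 1 + 1)) ^ (2 * (d + 1)) *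
      e3OfS (Lc ^ (n + 1 + 1)) (fun κ u => (((Lc : ℝ) ^ (d + 1)) ^ (n - m) * (cVH * ((Lc : ℝ) ^ (m + 1)) ^ (d + 2))) •
        pushSum (Lc ^ (m + 1 + 1)) (Lc ^ (n - m)) (borderInc d Lc (Lc ^ (m + 1)) κ u)) κ' u' x' z' a b) (cV * θ ^ (n - m)) δ)
    (hL : ∀ n m : ℕ, m < n → LocStencil (fun κ' u' x' z' a b => ((Lc : ℝ) ^ (n + 1 + 1)) ^ (2 * (d + 1)) *
      e3OfS (Lc ^ (n + 1 + 1)) (fun κ u => (((Lc : ℝ) ^ (d + 1)) ^ (n - m) * (cΛ * ((Lc : ℝ) ^ (m + 1)) ^ (2 * d + 4))) •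
        lagrInc d Lc (Lc ^ (m + 1)) (Lc ^ (m + 1 + 1)) κ u) κ' u' x' z' a b) (cL * θ ^ (n - m)) δ) :
    ∃ C₃ δ₃ : ℝ, 0 < δ₃ ∧ ∀ j : ℕ, LocStencil (unitS (sfStep Lc (j + 1)) (smStep d Lc (j + 1))
      (fun κ u => (cE * wE d Lc (j + 1)) • e3Of d Lc cE cVH cΛ (j + 1) κ u)) C₃ δ₃ := by
  -- member 1: ONE member, an2's existential localisation
  obtain ⟨C₁, δ₁, hδ₁, h1⟩ := locStencil_e3Of (d := d) (Lc := Lc) hLc cE cVH cΛ 1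
  have hC₁ : 0 ≤ C₁ := (h1 0 0).nonneg (Sum.inl 0)
  -- the uniform constant of the members ≥ 2
  have h1θ : 0 < 1 - θ := by linarith
  set K : ℝ := CW + |c₀V| + |c₀L| + CtV + CtL + (|cV| + |cL|) * (θ / (1 - θ)) with hK
  set δ₃ : ℝ := min δ₁ δ with hδ₃
  have hδ₃pos : 0 < δ₃ := lt_min hδ₁ hδ
  have hδ₃δ : δ₃ ≤ δ := min_le_right _ _
  have hδ₃δ₁ : δ₃ ≤ δ₁ := min_le_left _ _
  refine ⟨max (|cE * ((Lc : ℝ) ^ 1) ^ (2 * (d + 1))| * C₁) (|cE| * K), δ₃, hδ₃pos, fun j => ?_⟩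
  rw [unitS_e3Of]
  rcases j with _ | n
  · -- member 1
    have h := locStencil_smul (cE * ((Lc : ℝ) ^ (0 + 1)) ^ (2 * (d + 1))) (locStencil_mono h1 hC₁ hδ₃δ₁)
    simp only [zero_add] at h ⊢
    exact locStencil_const_mono h (le_max_left _ _)
  · -- member n+2: the decomposition, termwise
    intro κ' u' x z a b
    simp only [Pi.smul_apply, smul_eq_mul]
    rw [e3Of_succ_succ_decomp hLc cE cVH cΛ n κ' u' x z a b, mul_assoc, abs_mul]
    -- termwise bounds at the rate δ₃ ≤ δ
    have bW := abs_le_of_locStencil (hW n) hδ₃δ κ' u' x z a b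
    have bV0 := abs_le_of_locStencil (hV0 n) hδ₃δ κ' u' x z a b
    have bL0 := abs_le_of_locStencil (hL0 n) hδ₃δ κ' u' x z a b
    have bVt := abs_le_of_locStencil (hVt n) hδ₃δ κ' u' x z a b
    have bLt := abs_le_of_locStencil (hLt n) hδ₃δ κ' u' x z a b
    have bV : ∀ m ∈ Finset.range n, _ := fun m hm =>
      abs_le_of_locStencil (hV n m (Finset.mem_range.1 hm)) hδ₃δ κ' u' x z a b
    have bL : ∀ m ∈ Finset.range n, _ := fun m hm =>
      abs_le_of_locStencil (hL n m (Finset.mem_range.1 hm)) hδ₃δ κ' u' x z a b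
    have key := abs_weighted_sum_le (Finset.range n) bW bV0 bL0 bVt bLt bV bL
    -- the sum of the constants is ≤ K
    set E : ℝ := Real.exp (-δ₃ * (l1 (x - u') + l1 (z - u'))) with hE
    have hEpos : 0 ≤ E := (Real.exp_pos _).le
    have hp1 : θ ^ (n + 1) ≤ 1 := pow_le_one₀ hθ0 hθ1.le
    have hp0 : 0 ≤ θ ^ (n + 1) := pow_nonneg hθ0 _
    have hc0V : c₀V * θ ^ (n + 1) ≤ |c₀V| := by
      refine (le_abs_self _).trans ?_
      rw [abs_mul, abs_of_nonneg hp0]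
      exact (mul_le_mul_of_nonneg_left hp1 (abs_nonneg _)).trans (le_of_eq (mul_one _))
    have hc0L : c₀L * θ ^ (n + 1) ≤ |c₀L| := by
      refine (le_abs_self _).trans ?_
      rw [abs_mul, abs_of_nonneg hp0]
      exact (mul_le_mul_of_nonneg_left hp1 (abs_nonneg _)).trans (le_of_eq (mul_one _))
    have hlev : ∑ m ∈ Finset.range n, (cV * θ ^ (n - m) + cL * θ ^ (n - m)) ≤ (|cV| + |cL|) * (θ / (1 - θ)) := by
      rw [show ∑ m ∈ Finset.range n, (cV * θ ^ (n - m) + cL * θ ^ (n - m)) =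
          (cV + cL) * ∑ m ∈ Finset.range n, θ ^ (n - m) by
        rw [Finset.mul_sum]; exact Finset.sum_congr rfl fun m _ => by ring]
      have hs0 : 0 ≤ ∑ m ∈ Finset.range n, θ ^ (n - m) := Finset.sum_nonneg fun m _ => pow_nonneg hθ0 _
      calc (cV + cL) * ∑ m ∈ Finset.range n, θ ^ (n - m) ≤ (|cV| + |cL|) * ∑ m ∈ Finset.range n, θ ^ (n - m) :=
            mul_le_mul_of_nonneg_right ((le_abs_self _).trans (abs_add_le _ _)) hs0
        _ ≤ (|cV| + |cL|) * (θ / (1 - θ)) :=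
            mul_le_mul_of_nonneg_left (sum_pow_sub_le hθ0 hθ1 n) (by positivity)
    have hsumK : CW + c₀V * θ ^ (n + 1) + c₀L * θ ^ (n + 1) + CtV + CtL +
        ∑ m ∈ Finset.range n, (cV * θ ^ (n - m) + cL * θ ^ (n - m)) ≤ K := by
      rw [hK]; linarith
    calc |cE| * |((Lc : ℝ) ^ (n + 1 + 1)) ^ (2 * (d + 1)) * _| ≤ |cE| * ((CW + c₀V * θ ^ (n + 1) + c₀L * θ ^ (n + 1) + CtV + CtL +
          ∑ m ∈ Finset.range n, (cV * θ ^ (n - m) + cL * θ ^ (n - m))) * E) :=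
          mul_le_mul_of_nonneg_left key (abs_nonneg _)
      _ ≤ |cE| * (K * E) := mul_le_mul_of_nonneg_left (mul_le_mul_of_nonneg_right hsumK hEpos) (abs_nonneg _)
      _ = (|cE| * K) * E := by ring
      _ ≤ max (|cE * ((Lc : ℝ) ^ 1) ^ (2 * (d + 1))| * C₁) (|cE| * K) * E :=
          mul_le_mul_of_nonneg_right (le_max_right _ _) hEpos

end Summit.QuantumFields.BalabanUV.Beta.GAN24.StencilSlotE3OfPieces
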